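import Summits.QuantumFields.YangMills.Theorems.EntropyFloorHistoryTailOfGeometric
import HarnessLib

/-!
# Line «local_insertion» on crux `HistoryTailL` (stmt-QuantumFields-19936) — THE LINEAR-EXPONENTIAL PACKAGING DOOR:
# a per-plaquette tail `M₀·exp(−ε·p(g_(K−j)))` at every height, for profiles `(b₀, p₀)` we may choose large, gives `UnitScaleTilt.HistoryTailL`

Cell `ym3-torus` (YM ladder rung R3 = continuum SU(2) Yang–Mills on the three-torus — a RUNG, NOT the Clay problem: not
d = 4, not infinite volume, not a mass gap), width seat `ym-ust-19936-w3` gen 10; part (d) («packaging») of the route item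
`LocalInsertion.HistoryTailOfInsertionL` (stmt-QuantumFields-23608: `LocalInsertionL → HistoryTailL`), typed so that whoever proves the
Chernoff ∕ finest-bad-level recursion parts (a)–(c) can conclude by `exact`.  Nothing here proves 23608, `LocalInsertionL`, a stub of
`Cruxes/HistoryTailL/Lines/local_insertion.lean`, the crux `HistoryTailL` or a summit statement: this file is CONDITIONAL bookkeeping.

WHAT.  The line card's arithmetic «a LINEAR-exponential per-plaquette tail `M₀·e^{−ε·p(g)}` with ANY fixed `ε > 0` beats the plaquette counts
once `b₀ ≥ 8/ε`» is, by kernel, an instance of the tree's GEOMETRIC FLOOR DOOR ✓`EntropyFloorHistoryTailOfGeometric.historyTailL_of_geometricTail`: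
* §1 `half_mul_log_le_log_inv_coupling`: `h·log L/2 ≤ log g_h⁻¹` (`g_h² = γ·L^{−h}`, `γ ≤ 1`); `mul_log_inv_le_pFun`: `b₀·log g⁻¹ ≤ p(g)`
  (`p(g) = b₀(1 + log g⁻¹)^{p₀} ≥ b₀(1 + log g⁻¹)`, `p₀ ≥ 1`); ★`exp_neg_mul_pFun_le_pow`:
  `exp(−ε·p(g_h)) ≤ (exp(−ε·b₀·log L/2))^h` — the linear-exponential tail IS geometric with ratio `ρ = L^{−εb₀/2}`.
* §2 ★★`historyTailL_of_linExpTail`: if for every `L` there is `ε > 0` such that for ALL `b₀ > 0`, `p₀ > 2` there are `M₀ ≥ 0`, `γ₁ ∈ (0,1]`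
  with `Gibbs_K{θ(K−j) ≤ dist1(Ū^j(∂p))} ≤ M₀·exp(−ε·p(g_(K−j)))` for every family `F` (`F.L = L`), `0 < γ ≤ γ₁`, `1 ≤ j ≤ K`, `p` — the
  per-plaquette currency the insertion bound produces after Chernoff + recursion — then `UnitScaleTilt.HistoryTailL`: choose
  `b₀ := max (max b₁ 1) (8/ε)`, `p₀ := max p₁ 3`, `ρ := exp(−ε·b₀·log L/2)` (`ρ·L³ = exp((3 − εb₀/2)·log L) < 1` since `εb₀ ≥ 8`, `L > 1`),
  `D := M₀`, and call the geometric door.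
[folklore]
-/

noncomputable section

open scoped BigOperators
open MeasureTheory
open Literature.MathematicalPhysics.QuantumFieldTheory.Balaban1983to89
open Literature.MathematicalPhysics.QuantumFieldTheory.Balaban1983to89.T3ContinuumYM3Torus
open Literature.MathematicalPhysics.QuantumFieldTheory.Balaban1983to89.T3UnitScaleTilt
open Literature.MathematicalPhysics.QuantumFieldTheory.Balaban1983to89.T3UnitLawDensityEML
open Summit.QuantumFields.YangMills.Theorems.EntropyFloorHistoryTailOfGeometric (historyTailL_of_geometricTail)

namespace Summit.QuantumFields.YangMills.Theorems.LocalInsertionLinExpDoor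

/-! ## §1 The linear-exponential tail is geometric in the depth -/

/-- `h·log L/2 ≤ log g_h⁻¹` for the running coupling `g_h = √(γ·L^{−h})`, `0 < γ ≤ 1`, `1 ≤ L`. [cite: Balaban1985UV3, (3) p.256] -/
theorem half_mul_log_le_log_inv_coupling {L : ℕ} (hL : 1 ≤ L) {γ : ℝ} (hγ : 0 < γ) (hγ1 : γ ≤ 1) (h : ℕ) :
    (h : ℝ) * Real.log L / 2 ≤ Real.log (Real.sqrt (γ * ((L : ℝ)⁻¹) ^ h))⁻¹ := by
  have hL0 : (0 : ℝ) < L := by exact_mod_cast lt_of_lt_of_le zero_lt_one hL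
  have hx : 0 < γ * ((L : ℝ)⁻¹) ^ h := mul_pos hγ (pow_pos (inv_pos.mpr hL0) h)
  rw [Real.log_inv, Real.log_sqrt hx.le, Real.log_mul hγ.ne' (pow_pos (inv_pos.mpr hL0) h).ne', Real.log_pow,
    Real.log_inv]
  have hlogγ : Real.log γ ≤ 0 := Real.log_nonpos hγ.le hγ1
  linarith

/-- `b₀·log g⁻¹ ≤ p(g)` on `(0,1]` for `b₀ ≥ 0`, `p₀ ≥ 1` (`(1+x)^{p₀} ≥ 1 + x ≥ x` for `x ≥ 0`). [cite: Balaban1985UV3, (7) p.257] -/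
theorem mul_log_inv_le_pFun {b₀ p₀ g : ℝ} (hb₀ : 0 ≤ b₀) (hp₀ : 1 ≤ p₀) (hg : 0 < g) (hg1 : g ≤ 1) :
    b₀ * Real.log g⁻¹ ≤ B10.pFun b₀ p₀ g := by
  have hx : 0 ≤ Real.log g⁻¹ := B10.log_inv_nonneg_of_le_one hg hg1
  have h1 : 1 + Real.log g⁻¹ ≤ (1 + Real.log g⁻¹) ^ p₀ := by
    have := Real.rpow_le_rpow_of_exponent_le (by linarith : (1 : ℝ) ≤ 1 + Real.log g⁻¹) hp₀
    rwa [Real.rpow_one] at this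
  unfold B10.pFun
  exact mul_le_mul_of_nonneg_left (by linarith) hb₀

/-- **★ THE LINEAR-EXPONENTIAL TAIL IS GEOMETRIC**: `exp(−ε·p(g_h)) ≤ (exp(−ε·b₀·log L/2))^h` for `ε ≥ 0`, `b₀ ≥ 0`, `p₀ ≥ 1`,
`0 < γ ≤ 1`, `1 ≤ L`. [folklore] -/
theorem exp_neg_mul_pFun_le_pow {L : ℕ} (hL : 1 ≤ L) {γ : ℝ} (hγ : 0 < γ) (hγ1 : γ ≤ 1) {ε b₀ p₀ : ℝ} (hε : 0 ≤ ε)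
    (hb₀ : 0 ≤ b₀) (hp₀ : 1 ≤ p₀) (h : ℕ) :
    Real.exp (-(ε * B10.pFun b₀ p₀ (Real.sqrt (γ * ((L : ℝ)⁻¹) ^ h)))) ≤ Real.exp (-(ε * b₀ * Real.log L / 2)) ^ h := by
  have hL0 : (0 : ℝ) < L := by exact_mod_cast lt_of_lt_of_le zero_lt_one hL
  have hL1 : (1 : ℝ) ≤ L := by exact_mod_cast hL
  have hx : 0 < γ * ((L : ℝ)⁻¹) ^ h := mul_pos hγ (pow_pos (inv_pos.mpr hL0) h)
  have hx1 : γ * ((L : ℝ)⁻¹) ^ h ≤ 1 :=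
    (mul_le_of_le_one_right hγ.le (pow_le_one₀ (inv_nonneg.mpr hL0.le) (inv_le_one_of_one_le₀ hL1))).trans hγ1
  have hg : 0 < Real.sqrt (γ * ((L : ℝ)⁻¹) ^ h) := Real.sqrt_pos.mpr hx
  have hg1 : Real.sqrt (γ * ((L : ℝ)⁻¹) ^ h) ≤ 1 := Real.sqrt_le_one.mpr hx1
  have h1 := half_mul_log_le_log_inv_coupling hL hγ hγ1 h
  have h2 := mul_log_inv_le_pFun (p₀ := p₀) hb₀ hp₀ hg hg1
  rw [← Real.exp_nat_mul, Real.exp_le_exp]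
  have h3 : b₀ * ((h : ℝ) * Real.log L / 2) ≤ B10.pFun b₀ p₀ (Real.sqrt (γ * ((L : ℝ)⁻¹) ^ h)) :=
    (mul_le_mul_of_nonneg_left h1 hb₀).trans h2
  have h4 := mul_le_mul_of_nonneg_left h3 hε
  have e : (h : ℝ) * -(ε * b₀ * Real.log L / 2) = -(ε * (b₀ * ((h : ℝ) * Real.log L / 2))) := by ring
  rw [e]
  linarith

/-! ## §2 The door: a linear-exponential per-plaquette tail for large profiles gives `HistoryTailL` -/

/-- **★★ THE LINEAR-EXPONENTIAL PACKAGING DOOR INTO `UnitScaleTilt.HistoryTailL`.**  Suppose that for every `L` there is `ε > 0` such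
that for ALL profiles `b₀ > 0`, `p₀ > 2` there are `M₀ ≥ 0` and `γ₁ ∈ (0,1]` with the per-plaquette tail
`Gibbs_K{θ(K−j) ≤ dist1(Ū^j(∂p))} ≤ M₀·exp(−ε·p(g_(K−j)))` at every height `1 ≤ j ≤ K` of every family `F` with `F.L = L` and every
`0 < γ ≤ γ₁`.  Then `UnitScaleTilt.HistoryTailL` holds: for given thresholds `(b₁, p₁)` take `b₀ := max (max b₁ 1) (8/ε)`,
`p₀ := max p₁ 3`; the tail is geometric with ratio `ρ = exp(−εb₀·log L/2)` (`exp_neg_mul_pFun_le_pow`) and `ρ·L³ < 1` because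
`ε·b₀ ≥ 8 > 6` and `L > 1`; conclude by the geometric floor door ✓`historyTailL_of_geometricTail`.  This is part (d) of the glue
`LocalInsertion.HistoryTailOfInsertionL` (stmt-QuantumFields-23608); CONDITIONAL on its hypothesis, which is NOT proved here.
ON `ε`: the hypothesis is MONOTONE in `ε` — a tail bound at some `ε > 0` implies the same bound at every `ε' ∈ (0, ε]` (for `p(g) ≥ 0`,
`exp(−ε·p) ≤ exp(−ε'·p)`), and the door only asks for ONE positive `ε` per `L`; so a supplier with the shape `∃ ε₀, ∀ ε ≤ ε₀, …`
(the route crux `LocalInsertionL` after Chernoff) or with a Gaussian factor `exp(−¼p²) ≤ exp(−ε·p)` for `p ≥ 4ε` (NODE O's (71))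
feeds it with whatever positive `ε` it has — no matching of constants is needed. [folklore] -/
theorem historyTailL_of_linExpTail
    (h : ∀ (L : ℕ), ∃ ε : ℝ, 0 < ε ∧ ∀ (b₀ p₀ : ℝ), 0 < b₀ → 2 < p₀ → ∃ M₀ : ℝ, 0 ≤ M₀ ∧ ∃ γ₁ : ℝ, 0 < γ₁ ∧ γ₁ ≤ 1 ∧
      ∀ (F : T3Family) (γ : ℝ), F.L = L → 0 < γ → γ ≤ γ₁ → ∀ (K j : ℕ), 1 ≤ j → j ≤ K → ∀ (p : Plaq (F.P K) j),
        (gibbsK F ℰp γ K).real {U | θBal F.L γ b₀ p₀ (K - j) ≤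
            GaugeGroup.dist1 (GaugeField.plaqHol (Averaging.iter (fun i => BlockAveraging.blockAvg (P := F.P K) (j := i) ℰp) j U) p)}
          ≤ M₀ * Real.exp (-(ε * B10.pFun b₀ p₀ (Real.sqrt (γ * ((F.L : ℝ)⁻¹) ^ (K - j)))))) :
    Summit.QuantumFields.YangMills.Theses.UnitScaleTilt.HistoryTailL := by
  refine historyTailL_of_geometricTail fun L b₁ p₁ => ?_
  obtain ⟨ε, hε, hprof⟩ := h L
  -- the profile: `b₀ ≥ b₁`, `b₀ ≥ 1`, `b₀ ≥ 8/ε`; `p₀ ≥ p₁`, `p₀ ≥ 3`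
  set b₀ : ℝ := max (max b₁ 1) (8 / ε) with hb₀def
  set p₀ : ℝ := max p₁ 3 with hp₀def
  have hb₀1 : 1 ≤ b₀ := (le_max_right b₁ 1).trans (le_max_left _ _)
  have hb₀0 : 0 < b₀ := lt_of_lt_of_le one_pos hb₀1
  have hb₀ε : 8 / ε ≤ b₀ := le_max_right _ _
  have hp₀3 : 3 ≤ p₀ := le_max_right _ _
  obtain ⟨M₀, hM₀, γ₁, hγ₁, hγ₁1, hfam⟩ := hprof b₀ p₀ hb₀0 (by linarith)
  refine ⟨b₀, p₀, (le_max_left b₁ 1).trans (le_max_left _ _), le_max_left _ _, hb₀0, by linarith, γ₁, hγ₁, hγ₁1,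
    fun F γ hFL hγ hγle => ?_⟩
  -- the ratio `ρ = exp(−ε b₀ log L / 2)`, with `ρ·L³ < 1`
  have hL1 : 1 < L := by rw [← hFL]; exact F.hL.2
  have hL1' : (1 : ℝ) < L := by exact_mod_cast hL1
  have hlogL : 0 < Real.log L := Real.log_pos hL1'
  refine ⟨M₀, Real.exp (-(ε * b₀ * Real.log L / 2)), hM₀, (Real.exp_pos _).le, ?_, fun K j hj hjK p => ?_⟩
  · -- `ρ·L³ = exp((3 − εb₀/2)·log L) < 1`
    have hεb : 8 ≤ ε * b₀ := by
      have := mul_le_mul_of_nonneg_left hb₀ε hε.le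
      rwa [mul_div_cancel₀ _ hε.ne'] at this
    have hL3 : (L : ℝ) ^ 3 = Real.exp (3 * Real.log L) := by
      rw [← Real.exp_log (by linarith : (0 : ℝ) < L), ← Real.exp_nat_mul, Real.exp_log (by linarith : (0 : ℝ) < L)]
      norm_num
    rw [hL3, ← Real.exp_add, ← Real.exp_zero]
    exact Real.exp_lt_exp.mpr (by nlinarith)
  · have htail := hfam F γ hFL hγ hγle K j hj hjK p
    refine htail.trans (mul_le_mul_of_nonneg_left ?_ hM₀)
    rw [hFL]
    exact exp_neg_mul_pFun_le_pow hL1.le hγ (hγle.trans hγ₁1) hε.le hb₀0.le (by linarith) (K - j)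

end Summit.QuantumFields.YangMills.Theorems.LocalInsertionLinExpDoor

end
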